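import Mathlib.LinearAlgebra.Matrix.PosDef
import Mathlib.LinearAlgebra.Matrix.NonsingularInverse
import Mathlib.Analysis.Matrix.Order

/-!
# Route `AnisotropyChord` / H0 rotor rung — PART N22: two abstract resolvent lemmas (Krein / Birman–Schwinger bookkeeping)

PORT SPEC N22 of the theory seat `hubbard-h0-rotor-theory-1` (memo ROTOR-THEORY-19 §240 (iv′)): the two Mathlib-only
matrix lemmas under PROP K3(c) and LEMMA CS of the three-magnon END₃ certificate, typed and PROVED for positive-definite
complex matrices (`Φ_M(v) := Re⟨v, M⁻¹ v⟩`):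

* `re_quadForm_inv_ge_variational` — the variational principle `Φ_A(v) ≥ 2 Re⟨w, v⟩ − Re⟨w, A w⟩` for every trial
  vector `w` (complete the square: `⟨A⁻¹v − w, A (A⁻¹v − w)⟩ ≥ 0`);
* `re_quadForm_inv_antitone` — `A ≤ B` (Loewner) ⇒ `Φ_B(v) ≤ Φ_A(v)` (the inverse is operator-antitone; trial `w = B⁻¹v`);
* `secular_fixedPoint_ge` — for a Loewner-non-decreasing positive-definite family `t ↦ M(t)` on a set `S`, the secular
  function `Φ(t) = Φ_{M(t)}(v)` is antitone, so a fixed point `Φ(t⋆) = t⋆` and a test value `Φ(T) ≥ T` force `T ≤ t⋆`;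
* `gram_lower_bound` — `Φ_M(v) ≥ Re⟨c, G⁻¹ c⟩` for `G = Bᴴ M B`, `c = Bᴴ v` (trial `w = B G⁻¹ c`; Schur complement /
  Cauchy–Schwarz in the `M`-inner product).

T. Kato, *Perturbation Theory for Linear Operators* (1966) I §6 (resolvent monotonicity); R. Bhatia, *Matrix Analysis*
(1997) V.1 (operator monotonicity of `t ↦ −1/t`).  No definition is introduced.
-/

set_option linter.dupNamespace false

noncomputable section

open scoped ComplexOrder ComplexConjugate
open Matrix

namespace Summit.HubbardSuperconductivity.HubbardSuperconductivity.Theorems.AnisotropyChord.Transfer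

variable {n : Type*} [Fintype n] [DecidableEq n]

/-- `A A⁻¹ v = v` for a positive-definite matrix. [folklore] -/
theorem posDef_mulVec_inv_mulVec {A : Matrix n n ℂ} (hA : A.PosDef) (v : n → ℂ) :
    A *ᵥ (A⁻¹ *ᵥ v) = v := by
  rw [mulVec_mulVec, mul_nonsing_inv A ((isUnit_iff_isUnit_det A).mp hA.isUnit), one_mulVec]

/-- **Variational principle for the inverse quadratic form:** for positive-definite `A` and every trial vector `w`,
`2 Re⟨w, v⟩ − Re⟨w, A w⟩ ≤ Re⟨v, A⁻¹ v⟩` (equality at `w = A⁻¹ v`). Bhatia (1997) V.1. [folklore] -/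
theorem re_quadForm_inv_ge_variational {A : Matrix n n ℂ} (hA : A.PosDef) (v w : n → ℂ) :
    2 * (star w ⬝ᵥ v).re - (star w ⬝ᵥ A *ᵥ w).re ≤ (star v ⬝ᵥ A⁻¹ *ᵥ v).re := by
  -- conjugate symmetry of the dot product (real parts) and the Hermitian swap, inlined
  have hcomm : ∀ a b : n → ℂ, (star a ⬝ᵥ b).re = (star b ⬝ᵥ a).re := fun a b => by
    rw [star_dotProduct, Complex.star_def, Complex.conj_re]
  set u : n → ℂ := A⁻¹ *ᵥ v with hu
  have hAu : A *ᵥ u = v := by rw [hu]; exact posDef_mulVec_inv_mulVec hA v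
  clear_value u
  -- `0 ≤ ⟨u − w, A (u − w)⟩`
  have h0 : 0 ≤ (star (u - w) ⬝ᵥ A *ᵥ (u - w)).re := by
    have h := hA.posSemidef.re_dotProduct_nonneg (u - w)
    simpa using h
  -- expand
  have h1 : star (u - w) ⬝ᵥ A *ᵥ (u - w) =
      star u ⬝ᵥ A *ᵥ u - star u ⬝ᵥ A *ᵥ w - star w ⬝ᵥ A *ᵥ u + star w ⬝ᵥ A *ᵥ w := by
    rw [star_sub, mulVec_sub, sub_dotProduct, dotProduct_sub, dotProduct_sub]
    ring
  have h2 : star u ⬝ᵥ A *ᵥ u = star u ⬝ᵥ v := by rw [hAu]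
  have h3 : star u ⬝ᵥ A *ᵥ w = star v ⬝ᵥ w := by
    calc star u ⬝ᵥ A *ᵥ w = star (Aᴴ *ᵥ u) ⬝ᵥ w := by
          rw [star_mulVec, conjTranspose_conjTranspose, dotProduct_mulVec]
      _ = star v ⬝ᵥ w := by rw [hA.isHermitian.eq, hAu]
  have h4 : star w ⬝ᵥ A *ᵥ u = star w ⬝ᵥ v := by rw [hAu]
  rw [h1, h2, h3, h4, Complex.add_re, Complex.sub_re, Complex.sub_re, hcomm u v, hcomm v w] at h0
  linarith

/-- **The inverse is operator-antitone** (quadratic-form version): for positive-definite `A`, `B` with `A ≤ B` in the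
Loewner order, `Re⟨v, B⁻¹ v⟩ ≤ Re⟨v, A⁻¹ v⟩`. Bhatia (1997) Prop. V.1.6. [folklore] -/
theorem re_quadForm_inv_antitone {A B : Matrix n n ℂ} (hA : A.PosDef) (hB : B.PosDef)
    (hAB : (B - A).PosSemidef) (v : n → ℂ) :
    (star v ⬝ᵥ B⁻¹ *ᵥ v).re ≤ (star v ⬝ᵥ A⁻¹ *ᵥ v).re := by
  set w : n → ℂ := B⁻¹ *ᵥ v with hw
  have hBw : B *ᵥ w = v := by rw [hw]; exact posDef_mulVec_inv_mulVec hB v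
  have hvar := re_quadForm_inv_ge_variational hA v w
  -- `Re⟨w, v⟩ = Φ_B(v)` and `Re⟨w, B w⟩ = Φ_B(v)`
  have hcomm : ∀ a b : n → ℂ, (star a ⬝ᵥ b).re = (star b ⬝ᵥ a).re := fun a b => by
    rw [star_dotProduct, Complex.star_def, Complex.conj_re]
  have h1 : (star w ⬝ᵥ v).re = (star v ⬝ᵥ B⁻¹ *ᵥ v).re := by
    rw [hcomm]
  have h2 : (star w ⬝ᵥ B *ᵥ w).re = (star v ⬝ᵥ B⁻¹ *ᵥ v).re := by
    rw [hBw, hcomm]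
  -- `Re⟨w, A w⟩ ≤ Re⟨w, B w⟩`
  have h3 : (star w ⬝ᵥ A *ᵥ w).re ≤ (star w ⬝ᵥ B *ᵥ w).re := by
    have h := hAB.re_dotProduct_nonneg w
    rw [sub_mulVec, dotProduct_sub] at h
    have h' : 0 ≤ (star w ⬝ᵥ B *ᵥ w).re - (star w ⬝ᵥ A *ᵥ w).re := by simpa using h
    linarith
  linarith

/-- **Secular fixed points dominate test points.** Let `t ↦ M(t)` be positive definite and Loewner-non-decreasing on a
set `S ⊆ ℝ`, and `Φ(t) := Re⟨v, M(t)⁻¹ v⟩` (antitone on `S` by `re_quadForm_inv_antitone`).  If `Φ(t⋆) = t⋆` and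
`Φ(T) ≥ T` for `t⋆, T ∈ S`, then `T ≤ t⋆` («`Φ(T) ≥ T ⇒` every fixed point lies above `T`»).
Kato (1966) I §6; memo ROTOR-THEORY-19 §236 (PROP K3(c)). [folklore] -/
theorem secular_fixedPoint_ge {M : ℝ → Matrix n n ℂ} {S : Set ℝ} (hPD : ∀ t ∈ S, (M t).PosDef)
    (hmono : ∀ s ∈ S, ∀ t ∈ S, s ≤ t → (M t - M s).PosSemidef) (v : n → ℂ) {tstar T : ℝ}
    (hts : tstar ∈ S) (hT : T ∈ S) (hfix : (star v ⬝ᵥ (M tstar)⁻¹ *ᵥ v).re = tstar)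
    (hge : T ≤ (star v ⬝ᵥ (M T)⁻¹ *ᵥ v).re) : T ≤ tstar := by
  by_contra h
  rw [not_le] at h
  -- `Φ(T) ≤ Φ(t⋆) = t⋆ < T ≤ Φ(T)`
  have hanti := re_quadForm_inv_antitone (hPD tstar hts) (hPD T hT) (hmono tstar hts T hT h.le) v
  linarith

/-- **Gram (Schur-complement) lower bound for the inverse quadratic form:** for positive-definite `M`, any `B` with
`G := Bᴴ M B` positive definite and `c := Bᴴ v`, `Re⟨c, G⁻¹ c⟩ ≤ Re⟨v, M⁻¹ v⟩` (trial vector `w = B G⁻¹ c` in the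
variational principle; equality iff `M⁻¹ v ∈ range B`). Memo ROTOR-THEORY-19 §237 (LEMMA CS). [folklore] -/
theorem gram_lower_bound {m : Type*} [Fintype m] [DecidableEq m] {M : Matrix n n ℂ} (hM : M.PosDef)
    (B : Matrix n m ℂ) (hG : (Bᴴ * M * B).PosDef) (v : n → ℂ) :
    (star (Bᴴ *ᵥ v) ⬝ᵥ (Bᴴ * M * B)⁻¹ *ᵥ (Bᴴ *ᵥ v)).re ≤ (star v ⬝ᵥ M⁻¹ *ᵥ v).re := by
  set G : Matrix m m ℂ := Bᴴ * M * B with hGdef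
  set c : m → ℂ := Bᴴ *ᵥ v with hc
  set x : m → ℂ := G⁻¹ *ᵥ c with hx
  have hGx : G *ᵥ x = c := by rw [hx]; exact posDef_mulVec_inv_mulVec hG c
  have hvar := re_quadForm_inv_ge_variational hM v (B *ᵥ x)
  -- `⟨B x, v⟩ = ⟨x, c⟩`
  have h1 : star (B *ᵥ x) ⬝ᵥ v = star x ⬝ᵥ c := by
    rw [star_mulVec, hc, ← dotProduct_mulVec]
  -- `⟨B x, M B x⟩ = ⟨x, G x⟩ = ⟨x, c⟩`
  have h2 : star (B *ᵥ x) ⬝ᵥ M *ᵥ (B *ᵥ x) = star x ⬝ᵥ c := by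
    rw [star_mulVec, ← dotProduct_mulVec, mulVec_mulVec, mulVec_mulVec, ← hGdef, hGx]
  rw [h1, h2] at hvar
  -- `Re⟨x, c⟩ = Re⟨c, G⁻¹ c⟩`
  have h3 : (star x ⬝ᵥ c).re = (star c ⬝ᵥ G⁻¹ *ᵥ c).re := by
    rw [star_dotProduct, Complex.star_def, Complex.conj_re]
  linarith

end Summit.HubbardSuperconductivity.HubbardSuperconductivity.Theorems.AnisotropyChord.Transfer
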